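import Literature.Algebra.Homology.MapBifunctorQuasiIso
import Mathlib.Algebra.Homology.TotalComplexShift
import Mathlib.Algebra.Homology.HomotopyCategory.ShiftSequence
import Mathlib.Algebra.Homology.HomotopyCategory.SingleFunctors
import HarnessLib

/-!
# A morphism of bicomplexes with finitely many columns which is a quasi-isomorphism on every column induces a
# quasi-isomorphism of total complexes

Layer `Literature/Algebra/Homology` (pure homological algebra over Mathlib; 0 named facts, no `def`, no instances).
For an abelian category `C` (in which the total complexes in question exist) and bicomplexes
`K L : HomologicalComplex₂ C (up ℤ) (up ℤ)` — cochain complexes of cochain complexes, whose COLUMNS are the complexes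
`K.X p` — with columns vanishing outside `[a, b]` (Mathlib `CochainComplex.IsStrictlyGE a` / `IsStrictlyLE b` for
`K`, `L` as complexes of complexes):

* §1 `total_shortExact` — a short complex `X₁ → X₂ → X₃` of bicomplexes which is SPLIT column by column has a short
  exact (indeed degreewise split) sequence of total complexes `0 → Tot X₁ → Tot X₂ → Tot X₃ → 0` (the splittings
  are assembled summand by summand with `HomologicalComplex₂.totalDesc`);
* §2 `quasiIso_total_map_single_map_iff` — for one column, `Tot(ψ[b])` is a quasi-isomorphism iff `ψ` is
  (`Tot(X[0]) ≅ X` by the summand inclusions, `isIso_ιTotal_of_isZero`; then Mathlib's `totalShift₁Iso` and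
  `SingleFunctors.shiftIso` move column `0` to column `b`, `quasiIso_shift_iff`);
* §3 **`quasiIso_total_map_of_quasiIso_columns`** — if every column `φ.f p : K.X p ⟶ L.X p` of `φ : K ⟶ L` is a
  quasi-isomorphism, then `Tot(φ) = HomologicalComplex₂.total.map φ (up ℤ)` is a quasi-isomorphism: induction on
  `b - a` by the degreewise-split top-column truncation `K^b[b] ↪ K ↠ K/K^b[b]` (the tree's `HodgeTheory.TopTrunc`,
  applied in the abelian category of columns, made natural in `K` here: `topι_naturality`, `truncπ_naturality`,
  `quasiIso_truncMap_f`), §1, and two-out-of-three for quasi-isomorphisms (`HodgeTheory.quasiIso_τ₂`).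

This is the column version of Weibel 5.6.1–5.6.2 / Kashiwara–Schapira 12.5.4 in the special case `H_I(φ)` an
isomorphism, proved without spectral sequences (long exact homology sequences only), in Mathlib's
`HomologicalComplex₂.total` dialect; the tree has the same pattern for BIFUNCTOR totals
(`Algebra/Homology/MapBifunctorQuasiIso.quasiIso_mapBifunctorMap_id`) and for concrete first-quadrant double
complexes of modules (`Algebra/Homology/DoubleComplexRowQuasiIso`). No boundedness of the columns themselves is
needed; with infinitely many columns the statement fails without a uniform bound (the first-quadrant version follows
from this one degree by degree and is not given here). Typed as the totalisation brick of the Čech route to the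
comparison `D⁺(QCoh) ≃ D⁺_qc(Mod)` (Hartshorne RD II 7.19) sized in the cell `pub-hodge-ring2`; research route
conditional on HC_CM, not a corollary — nothing here refers to it.

## References

* C. A. Weibel, *An introduction to homological algebra* (1994), 1.2.6–1.2.8 (total complex, truncations, shift),
  Thm. 1.3.1 and Ex. 1.3.3 (long exact sequence, 5-lemma), 5.6.1–5.6.2 (double complexes), 2.7.3. [Weibel1994]
* The Stacks Project, Tag 012Z (total complex), Tag 0133 (acyclic double complexes). [StacksProject]
-/

noncomputable section

-- `GradedObject`/`HomologicalComplex₂.toGradedObject` are not reducible (as in Mathlib's `Algebra/Homology/TotalComplex.lean`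
-- and the tree's `Algebra/Homology/MapBifunctorQuasiIso.lean`).
set_option backward.isDefEq.respectTransparency false

open CategoryTheory CategoryTheory.Category CategoryTheory.Limits HomologicalComplex

universe v u

namespace Literature.Algebra.Homology

/-! ### §1 Degreewise-split short exact sequences of bicomplexes have short exact total complexes -/

section ShortExact

variable {C : Type u} [Category.{v} C] [Abelian C]
  [∀ K : HomologicalComplex₂ C (ComplexShape.up ℤ) (ComplexShape.up ℤ), K.HasTotal (ComplexShape.up ℤ)]

/-- `Tot` preserves the zero morphisms: `total.map 0 = 0`. [cite: Weibel1994, 1.2.6 (total complex)] -/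
theorem total_map_zero (K L : HomologicalComplex₂ C (ComplexShape.up ℤ) (ComplexShape.up ℤ)) :
    HomologicalComplex₂.total.map (0 : K ⟶ L) (ComplexShape.up ℤ) = 0 :=
  HomologicalComplex.hom_ext _ _ fun n => HomologicalComplex₂.total.hom_ext _ fun i₁ i₂ h => by
    rw [HomologicalComplex₂.ιTotal_map, HomologicalComplex.zero_f, HomologicalComplex.zero_f,
      HomologicalComplex.zero_f, zero_comp, comp_zero]

variable (S : ShortComplex (HomologicalComplex₂ C (ComplexShape.up ℤ) (ComplexShape.up ℤ)))

/-- `Tot(f) ≫ Tot(g) = 0` for a short complex `X₁ −f→ X₂ −g→ X₃` of bicomplexes. [cite: Weibel1994, 1.2.6 (total complex)] -/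
theorem total_map_f_comp_total_map_g :
    HomologicalComplex₂.total.map S.f (ComplexShape.up ℤ) ≫ HomologicalComplex₂.total.map S.g (ComplexShape.up ℤ) = 0 := by
  rw [← HomologicalComplex₂.total.map_comp, S.zero, total_map_zero]

/-- **`0 → Tot X₁ → Tot X₂ → Tot X₃ → 0` is short exact** (indeed degreewise split) when the short complex
`X₁ → X₂ → X₃` of bicomplexes is split in every COLUMN degree `i₁` (splittings of the short complexes of columns
`X₁^{i₁,•} → X₂^{i₁,•} → X₃^{i₁,•}`): in total degree `n` the retraction and the section are assembled summand by summand.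
[cite: Weibel1994, 1.2.6 and Ex. 1.2.8] -/
theorem total_shortExact
    (σ : ∀ i₁ : ℤ, (S.map (HomologicalComplex.eval (CochainComplex C ℤ) (ComplexShape.up ℤ) i₁)).Splitting) :
    (ShortComplex.mk _ _ (total_map_f_comp_total_map_g S)).ShortExact := by
  rw [HomologicalComplex.shortExact_iff_degreewise_shortExact]
  intro n
  let r : (S.X₂.total (ComplexShape.up ℤ)).X n ⟶ (S.X₁.total (ComplexShape.up ℤ)).X n :=
    S.X₂.totalDesc fun i₁ i₂ h => ((σ i₁).r).f i₂ ≫ S.X₁.ιTotal (ComplexShape.up ℤ) i₁ i₂ n h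
  let s : (S.X₃.total (ComplexShape.up ℤ)).X n ⟶ (S.X₂.total (ComplexShape.up ℤ)).X n :=
    S.X₃.totalDesc fun i₁ i₂ h => ((σ i₁).s).f i₂ ≫ S.X₂.ιTotal (ComplexShape.up ℤ) i₁ i₂ n h
  have h1 : (HomologicalComplex₂.total.map S.f (ComplexShape.up ℤ)).f n ≫ r = 𝟙 _ := by
    refine HomologicalComplex₂.total.hom_ext _ fun i₁ i₂ h => ?_
    have h' := congr_arg (fun φ => HomologicalComplex.Hom.f φ i₂ ≫ S.X₁.ιTotal (ComplexShape.up ℤ) i₁ i₂ n h)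
      (σ i₁).f_r
    simp only [ShortComplex.map_f, HomologicalComplex.eval_map, comp_f, id_f, Category.assoc, Category.id_comp] at h'
    simp only [r, HomologicalComplex₂.ιTotal_map_assoc, HomologicalComplex₂.ι_totalDesc, comp_id]
    exact h'
  have h2 : s ≫ (HomologicalComplex₂.total.map S.g (ComplexShape.up ℤ)).f n = 𝟙 _ := by
    refine HomologicalComplex₂.total.hom_ext _ fun i₁ i₂ h => ?_
    have h' := congr_arg (fun φ => HomologicalComplex.Hom.f φ i₂ ≫ S.X₃.ιTotal (ComplexShape.up ℤ) i₁ i₂ n h)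
      (σ i₁).s_g
    simp only [ShortComplex.map_g, HomologicalComplex.eval_map, comp_f, id_f, Category.assoc, Category.id_comp] at h'
    simp only [s, HomologicalComplex₂.ι_totalDesc_assoc, Category.assoc, HomologicalComplex₂.ιTotal_map, comp_id]
    exact h'
  have h3 : r ≫ (HomologicalComplex₂.total.map S.f (ComplexShape.up ℤ)).f n +
      (HomologicalComplex₂.total.map S.g (ComplexShape.up ℤ)).f n ≫ s = 𝟙 _ := by
    refine HomologicalComplex₂.total.hom_ext _ fun i₁ i₂ h => ?_
    have h' := congr_arg (fun φ => HomologicalComplex.Hom.f φ i₂ ≫ S.X₂.ιTotal (ComplexShape.up ℤ) i₁ i₂ n h)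
      (σ i₁).id
    simp only [ShortComplex.map_f, ShortComplex.map_g, HomologicalComplex.eval_map, comp_f, id_f, add_f_apply,
      Category.assoc, Category.id_comp, Preadditive.add_comp] at h'
    simp only [r, s, Preadditive.comp_add, HomologicalComplex₂.ι_totalDesc_assoc, Category.assoc,
      HomologicalComplex₂.ιTotal_map, HomologicalComplex₂.ιTotal_map_assoc, HomologicalComplex₂.ι_totalDesc, comp_id]
    exact h'
  exact (ShortComplex.Splitting.mk (S := (ShortComplex.mk _ _ (total_map_f_comp_total_map_g S)).map
    (HomologicalComplex.eval C (ComplexShape.up ℤ) n)) r s h1 h2 h3).shortExact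

end ShortExact

/-! ### §2 One column: `Tot(X[b]) ≃ X⟦-b⟧` up to quasi-isomorphism -/

section SingleColumn

variable {C : Type u} [Category.{v} C] [Abelian C]
  [∀ K : HomologicalComplex₂ C (ComplexShape.up ℤ) (ComplexShape.up ℤ), K.HasTotal (ComplexShape.up ℤ)]

omit [∀ K : HomologicalComplex₂ C (ComplexShape.up ℤ) (ComplexShape.up ℤ), K.HasTotal (ComplexShape.up ℤ)] in
/-- Off the column `b`, the entries of the one-column bicomplex `X[b]` are zero objects. [cite: Weibel1994, 1.2.6] -/
theorem isZero_single_obj_X_X (X : CochainComplex C ℤ) (b : ℤ) {i₁ : ℤ} (hi : i₁ ≠ b) (i₂ : ℤ) :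
    IsZero ((((single (CochainComplex C ℤ) (ComplexShape.up ℤ) b).obj X).X i₁).X i₂) :=
  Functor.map_isZero (HomologicalComplex.eval C (ComplexShape.up ℤ) i₂)
    (isZero_single_obj_X (ComplexShape.up ℤ) b X i₁ hi)

/-- In a bicomplex `K` whose columns other than `i₁` vanish in row... more precisely whose entries `(j₁, j₂)` with
`j₁ + j₂ = n`, `j₁ ≠ i₁` are zero, the summand inclusion `K^{i₁,i₂} ⟶ Tot(K)ⁿ` (`i₁ + i₂ = n`) is an isomorphism.
[cite: Weibel1994, 1.2.6 (total complex)] -/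
theorem isIso_ιTotal_of_isZero (K : HomologicalComplex₂ C (ComplexShape.up ℤ) (ComplexShape.up ℤ)) (i₁ i₂ n : ℤ)
    (h : i₁ + i₂ = n) (hK : ∀ j₁ j₂ : ℤ, j₁ + j₂ = n → j₁ ≠ i₁ → IsZero ((K.X j₁).X j₂)) :
    IsIso (K.ιTotal (ComplexShape.up ℤ) i₁ i₂ n h) := by
  classical
  refine ⟨⟨K.totalDesc fun j₁ j₂ hj =>
    if hj₁ : j₁ = i₁ then (K.XXIsoOfEq _ _ _ hj₁ (show j₂ = i₂ by change j₁ + j₂ = n at hj; omega)).hom else 0, ?_, ?_⟩⟩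
  · rw [HomologicalComplex₂.ι_totalDesc, dif_pos rfl, HomologicalComplex₂.XXIsoOfEq_rfl, Iso.refl_hom]
  · refine HomologicalComplex₂.total.hom_ext _ fun j₁ j₂ hj => ?_
    rw [HomologicalComplex₂.ι_totalDesc_assoc, comp_id]
    by_cases hj₁ : j₁ = i₁
    · subst hj₁
      obtain rfl : j₂ = i₂ := by change j₁ + j₂ = n at hj; omega
      rw [dif_pos rfl, HomologicalComplex₂.XXIsoOfEq_rfl, Iso.refl_hom, id_comp]
    · exact (hK j₁ j₂ hj hj₁).eq_of_src _ _

/-- **One column in degree `0`.** For a morphism `ψ : X ⟶ X'` of cochain complexes, `Tot(ψ[0])` — `ψ` viewed as a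
morphism of one-column bicomplexes concentrated in column `0` — is a quasi-isomorphism iff `ψ` is: the maps
`Xⁿ ≅ X[0]^{0,n} ⟶ Tot(X[0])ⁿ` form a natural isomorphism of complexes `X ≅ Tot(X[0])` (no sign: `ε₂(0, n) = 1`).
[cite: Weibel1994, 1.2.6 and Ex. 1.2.8] [cite: StacksProject, Tag 012Z] -/
theorem quasiIso_total_map_single_map_zero_iff {X X' : CochainComplex C ℤ} (ψ : X ⟶ X') :
    QuasiIso (HomologicalComplex₂.total.map ((single (CochainComplex C ℤ) (ComplexShape.up ℤ) 0).map ψ)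
      (ComplexShape.up ℤ)) ↔ QuasiIso ψ := by
  -- the comparison maps `Yⁿ ⟶ Tot(Y[0])ⁿ`
  let ι : ∀ (Y : CochainComplex C ℤ) (n : ℤ), Y.X n ⟶
      (HomologicalComplex₂.total ((single (CochainComplex C ℤ) (ComplexShape.up ℤ) 0).obj Y) (ComplexShape.up ℤ)).X n :=
    fun Y n => ((singleObjXSelf (ComplexShape.up ℤ) 0 Y).inv).f n ≫
      HomologicalComplex₂.ιTotal ((single (CochainComplex C ℤ) (ComplexShape.up ℤ) 0).obj Y) (ComplexShape.up ℤ) 0 n n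
        (zero_add n)
  have hι_iso : ∀ (Y : CochainComplex C ℤ) (n : ℤ), IsIso (ι Y n) := fun Y n => by
    haveI := isIso_ιTotal_of_isZero ((single (CochainComplex C ℤ) (ComplexShape.up ℤ) 0).obj Y) 0 n n (zero_add n)
      fun j₁ j₂ _ hj₁ => isZero_single_obj_X_X Y 0 hj₁ j₂
    exact IsIso.comp_isIso
  have hι_comm : ∀ (Y : CochainComplex C ℤ) (n : ℤ), ι Y n ≫
      (HomologicalComplex₂.total ((single (CochainComplex C ℤ) (ComplexShape.up ℤ) 0).obj Y) (ComplexShape.up ℤ)).d n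
        (n + 1) = Y.d n (n + 1) ≫ ι Y (n + 1) := fun Y n => by
    simp only [ι, Category.assoc, HomologicalComplex₂.total_d, Preadditive.comp_add, HomologicalComplex₂.ι_D₁,
      HomologicalComplex₂.ι_D₂]
    rw [HomologicalComplex₂.d₁_eq' _ _ (show (ComplexShape.up ℤ).Rel (0 : ℤ) 1 by simp) n (n + 1), single_obj_d,
      HomologicalComplex.zero_f, zero_comp, smul_zero, comp_zero, zero_add,
      HomologicalComplex₂.d₂_eq _ _ 0 (show (ComplexShape.up ℤ).Rel n (n + 1) by simp) (n + 1) (zero_add _)]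
    change _ ≫ ((((ComplexShape.up ℤ).ε (0 : ℤ)) • _)) = _
    rw [ComplexShape.ε_zero, one_smul, ← Category.assoc, HomologicalComplex.Hom.comm, Category.assoc]
  have hι_nat : ∀ n : ℤ, ι X n ≫ (HomologicalComplex₂.total.map
      ((single (CochainComplex C ℤ) (ComplexShape.up ℤ) 0).map ψ) (ComplexShape.up ℤ)).f n = ψ.f n ≫ ι X' n := fun n => by
    simp only [ι, Category.assoc, HomologicalComplex₂.ιTotal_map]
    rw [← comp_f_assoc, single_map_f_self, Iso.inv_hom_id_assoc, comp_f_assoc]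
  have hι_comm' : ∀ (Y : CochainComplex C ℤ) (i j : ℤ), (ComplexShape.up ℤ).Rel i j → ι Y i ≫
      (HomologicalComplex₂.total ((single (CochainComplex C ℤ) (ComplexShape.up ℤ) 0).obj Y) (ComplexShape.up ℤ)).d i
        j = Y.d i j ≫ ι Y j := by
    rintro Y i j (rfl : i + 1 = j)
    exact hι_comm Y i
  -- the natural isomorphism of complexes `Y ≅ Tot(Y[0])`
  let t : ∀ Y : CochainComplex C ℤ,
      Y ⟶ HomologicalComplex₂.total ((single (CochainComplex C ℤ) (ComplexShape.up ℤ) 0).obj Y) (ComplexShape.up ℤ) :=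
    fun Y => ⟨ι Y, hι_comm' Y⟩
  have ht : ∀ Y, IsIso (t Y) := fun Y => by
    haveI : ∀ n, IsIso ((t Y).f n) := fun n => hι_iso Y n
    exact HomologicalComplex.Hom.isIso_of_components (t Y)
  let e : Arrow.mk ψ ≅ Arrow.mk (HomologicalComplex₂.total.map
      ((single (CochainComplex C ℤ) (ComplexShape.up ℤ) 0).map ψ) (ComplexShape.up ℤ)) :=
    Arrow.isoMk (@asIso _ _ _ _ (t X) (ht X)) (@asIso _ _ _ _ (t X') (ht X'))
      (HomologicalComplex.hom_ext _ _ fun n => hι_nat n)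
  exact ⟨fun h => quasiIso_of_arrow_mk_iso _ _ e.symm, fun h => quasiIso_of_arrow_mk_iso _ _ e⟩

/-- `QuasiIso (Tot φ)` is invariant under isomorphisms of arrows of bicomplexes. [cite: Weibel1994, 1.2.6] -/
theorem quasiIso_total_map_iff_of_arrow_iso {K L K' L' : HomologicalComplex₂ C (ComplexShape.up ℤ) (ComplexShape.up ℤ)}
    {φ : K ⟶ L} {φ' : K' ⟶ L'} (e : Arrow.mk φ ≅ Arrow.mk φ') :
    QuasiIso (HomologicalComplex₂.total.map φ (ComplexShape.up ℤ)) ↔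
      QuasiIso (HomologicalComplex₂.total.map φ' (ComplexShape.up ℤ)) := by
  have hw : e.hom.left ≫ φ' = φ ≫ e.hom.right := Arrow.w e.hom
  let e' : Arrow.mk (HomologicalComplex₂.total.map φ (ComplexShape.up ℤ)) ≅
      Arrow.mk (HomologicalComplex₂.total.map φ' (ComplexShape.up ℤ)) :=
    Arrow.isoMk (HomologicalComplex₂.total.mapIso ((Arrow.leftFunc).mapIso e) (ComplexShape.up ℤ))
      (HomologicalComplex₂.total.mapIso ((Arrow.rightFunc).mapIso e) (ComplexShape.up ℤ)) (by
        change HomologicalComplex₂.total.map e.hom.left _ ≫ HomologicalComplex₂.total.map φ' _ =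
          HomologicalComplex₂.total.map φ _ ≫ HomologicalComplex₂.total.map e.hom.right _
        rw [← HomologicalComplex₂.total.map_comp, ← HomologicalComplex₂.total.map_comp, hw])
  exact ⟨fun h => quasiIso_of_arrow_mk_iso _ _ e', fun h => quasiIso_of_arrow_mk_iso _ _ e'.symm⟩

/-- `QuasiIso (Tot φ)` is invariant under the shift of the COLUMN index (`HomologicalComplex₂.shiftFunctor₁`; Mathlib's
sign-free `totalShift₁Iso : Tot(K⟦x⟧₁) ≅ (Tot K)⟦x⟧`, natural in `K`, and `quasiIso_shift_iff`). [cite: Weibel1994, 1.2.8] -/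
theorem quasiIso_total_map_shift₁_iff {K L : HomologicalComplex₂ C (ComplexShape.up ℤ) (ComplexShape.up ℤ)} (φ : K ⟶ L)
    (x : ℤ) :
    QuasiIso (HomologicalComplex₂.total.map ((HomologicalComplex₂.shiftFunctor₁ C x).map φ) (ComplexShape.up ℤ)) ↔
      QuasiIso (HomologicalComplex₂.total.map φ (ComplexShape.up ℤ)) := by
  rw [← CochainComplex.quasiIso_shift_iff (HomologicalComplex₂.total.map φ (ComplexShape.up ℤ)) x]
  let e : Arrow.mk (HomologicalComplex₂.total.map ((HomologicalComplex₂.shiftFunctor₁ C x).map φ) (ComplexShape.up ℤ)) ≅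
      Arrow.mk ((HomologicalComplex₂.total.map φ (ComplexShape.up ℤ))⟦x⟧') :=
    Arrow.isoMk (K.totalShift₁Iso x) (L.totalShift₁Iso x) (HomologicalComplex₂.totalShift₁Iso_hom_naturality φ x).symm
  exact ⟨fun h => quasiIso_of_arrow_mk_iso _ _ e, fun h => quasiIso_of_arrow_mk_iso _ _ e.symm⟩

/-- **One column in any degree `b`**: `Tot(ψ[b])` is a quasi-isomorphism iff `ψ` is (`X[b] ≅ X[0]⟦-b⟧₁` by Mathlib's
`SingleFunctors.shiftIso`, then the two invariances and the degree-`0` case). [cite: Weibel1994, 1.2.6 and 1.2.8] -/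
theorem quasiIso_total_map_single_map_iff {X X' : CochainComplex C ℤ} (ψ : X ⟶ X') (b : ℤ) :
    QuasiIso (HomologicalComplex₂.total.map ((single (CochainComplex C ℤ) (ComplexShape.up ℤ) b).map ψ)
      (ComplexShape.up ℤ)) ↔ QuasiIso ψ := by
  let e : ((single (CochainComplex C ℤ) (ComplexShape.up ℤ) 0 ⋙
      shiftFunctor (CochainComplex (CochainComplex C ℤ) ℤ) (-b))) ≅ single (CochainComplex C ℤ) (ComplexShape.up ℤ) b :=
    (CochainComplex.singleFunctors (CochainComplex C ℤ)).shiftIso (-b) b 0 (by omega)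
  have ea : Arrow.mk ((HomologicalComplex₂.shiftFunctor₁ C (-b)).map
      ((single (CochainComplex C ℤ) (ComplexShape.up ℤ) 0).map ψ)) ≅
      Arrow.mk ((single (CochainComplex C ℤ) (ComplexShape.up ℤ) b).map ψ) :=
    Arrow.isoMk (e.app X) (e.app X') (e.hom.naturality ψ).symm
  rw [← quasiIso_total_map_iff_of_arrow_iso ea, quasiIso_total_map_shift₁_iff, quasiIso_total_map_single_map_zero_iff]

end SingleColumn

/-! ### §3 Finitely many columns: induction on the number of columns -/

section Columns

variable {C : Type u} [Category.{v} C] [Abelian C]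
  [∀ K : HomologicalComplex₂ C (ComplexShape.up ℤ) (ComplexShape.up ℤ), K.HasTotal (ComplexShape.up ℤ)]

open Literature.AlgebraicGeometry.HodgeTheory

omit [∀ K : HomologicalComplex₂ C (ComplexShape.up ℤ) (ComplexShape.up ℤ), K.HasTotal (ComplexShape.up ℤ)] in
/-- The entries of a bicomplex all of whose columns are zero objects are zero. [cite: Weibel1994, 1.2.6] -/
theorem isZero_X_X_of_isZero_X (K : HomologicalComplex₂ C (ComplexShape.up ℤ) (ComplexShape.up ℤ)) {i₁ : ℤ}
    (h : IsZero (K.X i₁)) (i₂ : ℤ) : IsZero ((K.X i₁).X i₂) :=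
  Functor.map_isZero (HomologicalComplex.eval C (ComplexShape.up ℤ) i₂) h

/-- `Tot(K)ⁿ = 0` when every column of `K` is a zero object. [cite: Weibel1994, 1.2.6] -/
theorem isZero_total_X_of_isZero_X (K : HomologicalComplex₂ C (ComplexShape.up ℤ) (ComplexShape.up ℤ))
    (hK : ∀ i₁ : ℤ, IsZero (K.X i₁)) (n : ℤ) : IsZero ((K.total (ComplexShape.up ℤ)).X n) := by
  rw [IsZero.iff_id_eq_zero]
  exact HomologicalComplex₂.total.hom_ext _ fun i₁ i₂ _ => (isZero_X_X_of_isZero_X K (hK i₁) i₂).eq_of_src _ _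

omit [∀ K : HomologicalComplex₂ C (ComplexShape.up ℤ) (ComplexShape.up ℤ), K.HasTotal (ComplexShape.up ℤ)] in
/-- A morphism between zero objects of `C(C)` (all terms zero) is a quasi-isomorphism. [cite: Weibel1994, 1.1] -/
theorem quasiIso_of_isZero {X X' : CochainComplex C ℤ} (ψ : X ⟶ X') (hX : IsZero X) (hX' : IsZero X') : QuasiIso ψ :=
  quasiIso_of_isZero_X ψ (fun n => Functor.map_isZero (HomologicalComplex.eval C (ComplexShape.up ℤ) n) hX)
    (fun n => Functor.map_isZero (HomologicalComplex.eval C (ComplexShape.up ℤ) n) hX')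

variable {K L : HomologicalComplex₂ C (ComplexShape.up ℤ) (ComplexShape.up ℤ)} (φ : K ⟶ L) (b : ℤ)
  [CochainComplex.IsStrictlyLE K b] [CochainComplex.IsStrictlyLE L b]

omit [∀ K : HomologicalComplex₂ C (ComplexShape.up ℤ) (ComplexShape.up ℤ), K.HasTotal (ComplexShape.up ℤ)] in
/-- **Naturality of the top-column truncation**: `φ : K ⟶ L` (bicomplexes with no columns beyond `b`) induces a morphism
of the degreewise-split short exact sequences `K^b[b] ↪ K ↠ K/K^b[b]` and `L^b[b] ↪ L ↠ L/L^b[b]` of the tree's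
`HodgeTheory.TopTrunc`, with first component `φ^b[b]` and third component the induced map of cokernels.
[cite: Weibel1994, 1.2.7 (brutal truncations)] -/
theorem topι_naturality :
    TopTrunc.topι K b ≫ φ = (single (CochainComplex C ℤ) (ComplexShape.up ℤ) b).map (φ.f b) ≫ TopTrunc.topι L b := by
  refine from_single_hom_ext ?_
  rw [comp_f, comp_f, single_map_f_self, TopTrunc.topι_f_self, TopTrunc.topι_f_self, Category.assoc, Category.assoc,
    Iso.inv_hom_id, comp_id]

omit [∀ K : HomologicalComplex₂ C (ComplexShape.up ℤ) (ComplexShape.up ℤ), K.HasTotal (ComplexShape.up ℤ)] in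
/-- The induced map of the quotients `K/K^b[b] ⟶ L/L^b[b]` commutes with the projections.
[cite: Weibel1994, 1.2.7 (brutal truncations)] -/
theorem truncπ_naturality :
    cokernel.π (TopTrunc.topι K b) ≫ cokernel.map (TopTrunc.topι K b) (TopTrunc.topι L b)
      ((single (CochainComplex C ℤ) (ComplexShape.up ℤ) b).map (φ.f b)) φ (topι_naturality φ b) =
      φ ≫ cokernel.π (TopTrunc.topι L b) :=
  cokernel.π_desc _ _ _

omit [∀ K : HomologicalComplex₂ C (ComplexShape.up ℤ) (ComplexShape.up ℤ), K.HasTotal (ComplexShape.up ℤ)] in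
/-- **The columns of the induced map of quotients are quasi-isomorphisms** when those of `φ` are: in column `p ≠ b`
the projections `K^p ⟶ (K/K^b[b])^p` are isomorphisms, in column `b` both quotients vanish.
[cite: Weibel1994, 1.2.7 (brutal truncations)] -/
theorem quasiIso_truncMap_f (hφ : ∀ p, QuasiIso (φ.f p)) (p : ℤ) :
    QuasiIso ((cokernel.map (TopTrunc.topι K b) (TopTrunc.topι L b)
      ((single (CochainComplex C ℤ) (ComplexShape.up ℤ) b).map (φ.f b)) φ (topι_naturality φ b)).f p) := by
  by_cases hp : p = b
  · subst hp
    exact quasiIso_of_isZero _ (TopTrunc.isZero_trunc_X_self K p) (TopTrunc.isZero_trunc_X_self L p)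
  · haveI := TopTrunc.isIso_truncπ_f K b p hp
    haveI := TopTrunc.isIso_truncπ_f L b p hp
    haveI := hφ p
    exact quasiIso_of_arrow_mk_iso (φ.f p) _
      (Arrow.isoMk (asIso ((cokernel.π (TopTrunc.topι K b)).f p)) (asIso ((cokernel.π (TopTrunc.topι L b)).f p)) (by
        change (cokernel.π (TopTrunc.topι K b)).f p ≫ (cokernel.map (TopTrunc.topι K b) (TopTrunc.topι L b)
            ((single (CochainComplex C ℤ) (ComplexShape.up ℤ) b).map (φ.f b)) φ (topι_naturality φ b)).f p =
          φ.f p ≫ (cokernel.π (TopTrunc.topι L b)).f p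
        rw [← comp_f, truncπ_naturality, comp_f]))

variable {φ b} in
/-- **Induction step**: if `Tot` of the top-column part `φ^b[b]` and of the induced map of quotients are
quasi-isomorphisms, so is `Tot(φ)` (two-out-of-three on the short exact sequences of total complexes, §1, with the
degreewise splittings of the truncation sequences). [cite: Weibel1994, Thm. 1.3.1 and Ex. 1.3.3] -/
theorem quasiIso_total_map_of_truncSES
    (h₁ : QuasiIso (HomologicalComplex₂.total.map
      ((single (CochainComplex C ℤ) (ComplexShape.up ℤ) b).map (φ.f b)) (ComplexShape.up ℤ)))
    (h₃ : QuasiIso (HomologicalComplex₂.total.map (cokernel.map (TopTrunc.topι K b) (TopTrunc.topι L b)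
      ((single (CochainComplex C ℤ) (ComplexShape.up ℤ) b).map (φ.f b)) φ (topι_naturality φ b)) (ComplexShape.up ℤ))) :
    QuasiIso (HomologicalComplex₂.total.map φ (ComplexShape.up ℤ)) := by
  let TK := ShortComplex.mk _ _ (total_map_f_comp_total_map_g (TopTrunc.truncSES K b))
  let TL := ShortComplex.mk _ _ (total_map_f_comp_total_map_g (TopTrunc.truncSES L b))
  have hTK : TK.ShortExact := total_shortExact (TopTrunc.truncSES K b) (TopTrunc.truncSESSplitting K b)
  have hTL : TL.ShortExact := total_shortExact (TopTrunc.truncSES L b) (TopTrunc.truncSESSplitting L b)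
  let Φ : TK ⟶ TL := ShortComplex.homMk
    (HomologicalComplex₂.total.map ((single (CochainComplex C ℤ) (ComplexShape.up ℤ) b).map (φ.f b)) (ComplexShape.up ℤ))
    (HomologicalComplex₂.total.map φ (ComplexShape.up ℤ))
    (HomologicalComplex₂.total.map (cokernel.map (TopTrunc.topι K b) (TopTrunc.topι L b)
      ((single (CochainComplex C ℤ) (ComplexShape.up ℤ) b).map (φ.f b)) φ (topι_naturality φ b)) (ComplexShape.up ℤ))
    (by
      change HomologicalComplex₂.total.map _ _ ≫ HomologicalComplex₂.total.map (TopTrunc.topι L b) _ =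
        HomologicalComplex₂.total.map (TopTrunc.topι K b) _ ≫ HomologicalComplex₂.total.map _ _
      rw [← HomologicalComplex₂.total.map_comp, ← HomologicalComplex₂.total.map_comp, ← topι_naturality])
    (by
      change HomologicalComplex₂.total.map _ _ ≫ HomologicalComplex₂.total.map (cokernel.π (TopTrunc.topι L b)) _ =
        HomologicalComplex₂.total.map (cokernel.π (TopTrunc.topι K b)) _ ≫ HomologicalComplex₂.total.map _ _
      rw [← HomologicalComplex₂.total.map_comp, ← HomologicalComplex₂.total.map_comp, truncπ_naturality])
  exact quasiIso_τ₂ Φ hTK hTL h₁ h₃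

omit [CochainComplex.IsStrictlyLE K b] [CochainComplex.IsStrictlyLE L b]

variable {φ b} in
/-- Induction on the number of columns. [cite: Weibel1994, 1.2.7–1.2.8 and Thm. 1.3.1] -/
theorem quasiIso_total_map_aux (m : ℕ) :
    ∀ (K L : HomologicalComplex₂ C (ComplexShape.up ℤ) (ComplexShape.up ℤ)) (φ : K ⟶ L) (a b : ℤ), b - a < m →
      CochainComplex.IsStrictlyGE K a → CochainComplex.IsStrictlyLE K b →
      CochainComplex.IsStrictlyGE L a → CochainComplex.IsStrictlyLE L b →
      (∀ p, QuasiIso (φ.f p)) → QuasiIso (HomologicalComplex₂.total.map φ (ComplexShape.up ℤ)) := by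
  induction m with
  | zero =>
    intro K L φ a b hab _ _ _ _ _
    have hK : ∀ i₁ : ℤ, IsZero (K.X i₁) := fun p => by
      by_cases hp : p < a
      · exact CochainComplex.isZero_of_isStrictlyGE K a p hp
      · exact CochainComplex.isZero_of_isStrictlyLE K b p (by lia)
    have hL : ∀ i₁ : ℤ, IsZero (L.X i₁) := fun p => by
      by_cases hp : p < a
      · exact CochainComplex.isZero_of_isStrictlyGE L a p hp
      · exact CochainComplex.isZero_of_isStrictlyLE L b p (by lia)
    exact quasiIso_of_isZero_X _ (isZero_total_X_of_isZero_X K hK) (isZero_total_X_of_isZero_X L hL)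
  | succ m ih =>
    intro K L φ a b hab _ _ _ _ hφ
    refine quasiIso_total_map_of_truncSES (b := b) ((quasiIso_total_map_single_map_iff (φ.f b) b).2 (hφ b)) ?_
    exact ih _ _ _ a (b - 1) (by lia) (TopTrunc.trunc_isStrictlyGE K b a) (TopTrunc.trunc_isStrictlyLE K b)
      (TopTrunc.trunc_isStrictlyGE L b a) (TopTrunc.trunc_isStrictlyLE L b) (quasiIso_truncMap_f φ b hφ)

/-- **A morphism of bicomplexes with finitely many columns which is a quasi-isomorphism on every column induces a
quasi-isomorphism on total complexes.** Let `C` be an abelian category in which the relevant total complexes exist,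
`K`, `L` bicomplexes (`HomologicalComplex₂ C (up ℤ) (up ℤ)`, i.e. cochain complexes of cochain complexes; the
COLUMNS are the complexes `K.X p`) whose columns vanish outside `[a, b]` (Mathlib `CochainComplex.IsStrictlyGE a`,
`IsStrictlyLE b` for `K`, `L` as complexes of complexes), and `φ : K ⟶ L` a morphism whose every column
`φ.f p : K.X p ⟶ L.X p` is a quasi-isomorphism. Then `Tot(φ) = HomologicalComplex₂.total.map φ` is a
quasi-isomorphism. Proof: induction on `b - a` by the degreewise-split top-column truncation
`K^b[b] ↪ K ↠ K/K^b[b]` (the tree's `HodgeTheory.TopTrunc`, applied in the abelian category of columns), the short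
exactness of `Tot` on it (§1), two-out-of-three for quasi-isomorphisms (`HodgeTheory.quasiIso_τ₂`) and the one-column
case (§2). No boundedness of the columns themselves is needed. (With infinitely many columns the statement is false
without a uniform bound; the first-quadrant version follows from this one degree by degree and is not given here.)
[cite: Weibel1994, 5.6.1–5.6.2 and Thm. 5.2.12 (comparison), 2.7.3] [cite: StacksProject, Tag 0133] -/
theorem quasiIso_total_map_of_quasiIso_columns (K L : HomologicalComplex₂ C (ComplexShape.up ℤ) (ComplexShape.up ℤ))
    (φ : K ⟶ L) (a b : ℤ) [CochainComplex.IsStrictlyGE K a] [CochainComplex.IsStrictlyLE K b]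
    [CochainComplex.IsStrictlyGE L a] [CochainComplex.IsStrictlyLE L b] (hφ : ∀ p, QuasiIso (φ.f p)) :
    QuasiIso (HomologicalComplex₂.total.map φ (ComplexShape.up ℤ)) :=
  quasiIso_total_map_aux (b - a).toNat.succ K L φ a b (by lia) inferInstance inferInstance inferInstance inferInstance hφ

end Columns

end Literature.Algebra.Homology

end
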